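import Literature.NumberTheory.ComplexMultiplication.EllipticUnits.GrossencharacterFrobeniusInverse
import Literature.NumberTheory.ComplexMultiplication.EllipticUnits.LatticeRepsPermutation
import Literature.NumberTheory.NumberFields.RayClassFieldArtinSymbolSurjective
import Literature.NumberTheory.EllipticCurves.EisensteinNumbers
import HarnessLib

/-!
# de Shalit II.1.5 (vii) for an ARBITRARY `g ∈ Γ_K`: `ι̂(g·x(ξ z)) = x(ξ(ψ(𝔟)z))` when `g|_{K(𝔣𝔠)} = (𝔟, K(𝔣𝔠)/K)` — the Galois transport of
# division-point readings (base point, division values, model coordinates), its label-independence modulo `Λ`, and the induced permutation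
# of representatives (proofs only, from the clauses (vi)(vii) of II.1.5 as hypotheses)

Topic `NumberTheory/ComplexMultiplication/EllipticUnits` (theorems only; no definition, no named fact, no instance, no `sorry`).  Cell
`bsd-print-cf2`, width seat `bsd-line-cf2-p1-w8` g13, piece V1-perm of the `j = 0` seam values [I2] (crux 20368): the complex reading of the
value formulas is `φ_ℂ = ι̂_∞ ∘ (τ⁻¹ •) ∘ j` (reading conjugacy), so every theta datum read algebraically (`ι̂ X = ℘(z) − b`, …) must be MOVED
by `τ⁻¹ ∈ Γ_K`.  With `τ⁻¹|_{K(𝔣𝔠)} = (𝔟, K(𝔣𝔠)/K)` (`exists_ideal_artinSymbol_eq_absRestrictNormalHom`) and clause (vii) of II.1.5 AT `𝔟`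
(a hypothesis `hvii𝔟`; the consumer specialises the print's `∀ 𝔞 coprime`), companion of `GrossencharacterFrobeniusInverse` (`g = σ_v⁻¹`):

* §1 `coe_absRestrictNormalHom_apply_eq_smul` (`↑(g|_F x) = g • ↑x`); ★ `algClosureEmb_smul_eq_of_absRestrictNormalHom_eq` — **`ι̂(g • x) = ℘(ι ψ𝔟·z)`,
  `ι̂(g • y) = ℘′(ι ψ𝔟·z)`**; ★ `algClosureEmb_smul_model_eq_of_absRestrictNormalHom_eq` — the same for the MODEL coordinates
  `X = x − b₂/12`, `Y = (y − a₁X − a₃)/2` of an integral model `W/ℤ` (`g` fixes `ℤ`).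
* §2 ★ `sub_mem_lattice_of_model_readings_eq` — **label independence**: two analytic arguments `z₁, z₂ ∉ Λ` with the same model readings
  differ by `Λ` (`℘`, `℘′` separate `ℂ/Λ ∖ 0`), hence `eisensteinE_eq_of_model_readings_eq`: `E_k(z₁; Λ′) = E_k(z₂; Λ′)` for every `Λ′ ⊇ Λ`.
* §3 ★ `exists_perm_readings_of_absRestrictNormalHom_eq` — for representatives `S` of `𝔞⁻¹Λ/Λ` and `δ` with `δψ𝔟 ≡ 1 (mod 𝔞)`: a bijection
  `e` of `S ∖ 0` with **`ι̂(g • X_{e c}) = ℘(c) − b₂/12`** (the moved division values re-indexed: `x′ := x ∘ e` presents the SAME theta product).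

No summit statement is proved; BSD is not proved by any of this.

## References
* [deShalit1987] E. de Shalit, *Iwasawa theory of elliptic curves with complex multiplication* (1987), II §1.5 (15) (18) (p. 42–43), II §2.3
  (10), II §4.9 Proposition (ii) (proof, p. 63), II §4.14 (38) (p. 71).
* [Shimura1971] G. Shimura, *Introduction to the Arithmetic Theory of Automorphic Functions* (1971), Thm. 5.4, Prop. 7.40.
* [SilvermanAEC2009] J. H. Silverman, *The Arithmetic of Elliptic Curves*, 2nd ed. (2009), III.1, VI.3.6 (b).
-/

noncomputable section

open _root_.NumberField _root_.IsDedekindDomain PeriodPair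

namespace Literature.NumberTheory.ComplexMultiplication.EllipticUnits

open Literature.NumberTheory.NumberFields (rayClassField)
open Literature.NumberTheory.GaloisRepresentations (galFrob absRestrictNormalHom)
open Literature.NumberTheory.LFunctions.AbelianDensity (artinSymbol)
open Field

variable {K : Type} [Field K] [NumberField K] (ι : K →+* ℂ) {L : PeriodPair} {𝔣 𝔠 𝔟 : Ideal (𝓞 K)} {ψ : Ideal (𝓞 K) → 𝓞 K}

/-! ## §1 `ι̂(g • x) = ℘(ψ(𝔟)·z)` for `g|_{K(𝔣𝔠)} = (𝔟, K(𝔣𝔠)/K)` -/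

omit [NumberField K] in
/-- `↑(g|_F x) = g • ↑x` for a normal subextension `F ⊆ K̄` (unfolding of the restriction). [cite: deShalit1987, II §1.5 (p. 42)] -/
theorem coe_absRestrictNormalHom_apply_eq_smul (F : IntermediateField K (AlgebraicClosure K)) [Normal K F] (g : absoluteGaloisGroup K) (x : F) :
    ((absRestrictNormalHom F g x : F) : AlgebraicClosure K) = g • (x : AlgebraicClosure K) :=
  AlgEquiv.restrictNormalHom_apply F _ x

/-- ★ **II.1.5 (vii) for any `g ∈ Γ_K` restricting to the Artin symbol of `𝔟` on `K(𝔣𝔠)`**: for `z ∈ 𝔠⁻¹Λ ∖ Λ` with coordinates `x, y ∈ K(𝔣𝔠)`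
(`ι̂ x = ℘ z`, `ι̂ y = ℘′ z`): `ι̂(g • x) = ℘(ι ψ𝔟 · z)` and `ι̂(g • y) = ℘′(ι ψ𝔟 · z)` — given clause (vii) at `𝔟`.
[cite: deShalit1987, II §1.5 (15) (p. 42)] [cite: Shimura1971, Thm. 5.4] -/
theorem algClosureEmb_smul_eq_of_absRestrictNormalHom_eq
    (hvii𝔟 : ∀ z : ℂ, z ∈ idealInvLattice ι 𝔠 L.lattice → z ∉ L.lattice → ∀ x y : rayClassField K (𝔣 * 𝔠),
      algClosureEmb ι x = ℘[L] z → algClosureEmb ι y = ℘'[L] z →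
        algClosureEmb ι (artinSymbol (galFrob K (rayClassField K (𝔣 * 𝔠))) 𝔟 x) = ℘[L] (ι (ψ 𝔟 : K) * z) ∧
        algClosureEmb ι (artinSymbol (galFrob K (rayClassField K (𝔣 * 𝔠))) 𝔟 y) = ℘'[L] (ι (ψ 𝔟 : K) * z))
    {g : absoluteGaloisGroup K} (hg : absRestrictNormalHom (rayClassField K (𝔣 * 𝔠)) g = artinSymbol (galFrob K (rayClassField K (𝔣 * 𝔠))) 𝔟)
    {z : ℂ} (hz : z ∈ idealInvLattice ι 𝔠 L.lattice) (hz' : z ∉ L.lattice)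
    {x y : rayClassField K (𝔣 * 𝔠)} (hx : algClosureEmb ι x = ℘[L] z) (hy : algClosureEmb ι y = ℘'[L] z) :
    algClosureEmb ι (g • (x : AlgebraicClosure K)) = ℘[L] (ι (ψ 𝔟 : K) * z) ∧
      algClosureEmb ι (g • (y : AlgebraicClosure K)) = ℘'[L] (ι (ψ 𝔟 : K) * z) := by
  rw [← coe_absRestrictNormalHom_apply_eq_smul, ← coe_absRestrictNormalHom_apply_eq_smul, hg]
  exact hvii𝔟 z hz hz' x y hx hy

/-- ★ **The same in the MODEL coordinates of an integral model `W/ℤ`**: for `X, Y ∈ K(𝔣𝔠) ⊆ K̄` with `ι̂ X = ℘(z) − b₂/12`,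
`ι̂ Y = (℘′(z) − a₁(℘(z) − b₂/12) − a₃)/2`: `ι̂(g • X) = ℘(ι ψ𝔟·z) − b₂/12` and `ι̂(g • Y) = (℘′(ι ψ𝔟·z) − a₁(℘(ι ψ𝔟·z) − b₂/12) − a₃)/2`
(`g` fixes the integer coefficients). [cite: deShalit1987, II §1.5 (15) (p. 42)] [cite: SilvermanAEC2009, III.1] -/
theorem algClosureEmb_smul_model_eq_of_absRestrictNormalHom_eq (W : WeierstrassCurve ℤ)
    (hvii𝔟 : ∀ z : ℂ, z ∈ idealInvLattice ι 𝔠 L.lattice → z ∉ L.lattice → ∀ x y : rayClassField K (𝔣 * 𝔠),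
      algClosureEmb ι x = ℘[L] z → algClosureEmb ι y = ℘'[L] z →
        algClosureEmb ι (artinSymbol (galFrob K (rayClassField K (𝔣 * 𝔠))) 𝔟 x) = ℘[L] (ι (ψ 𝔟 : K) * z) ∧
        algClosureEmb ι (artinSymbol (galFrob K (rayClassField K (𝔣 * 𝔠))) 𝔟 y) = ℘'[L] (ι (ψ 𝔟 : K) * z))
    {g : absoluteGaloisGroup K} (hg : absRestrictNormalHom (rayClassField K (𝔣 * 𝔠)) g = artinSymbol (galFrob K (rayClassField K (𝔣 * 𝔠))) 𝔟)
    {z : ℂ} (hz : z ∈ idealInvLattice ι 𝔠 L.lattice) (hz' : z ∉ L.lattice)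
    {X Y : AlgebraicClosure K} (hXm : X ∈ rayClassField K (𝔣 * 𝔠)) (hYm : Y ∈ rayClassField K (𝔣 * 𝔠))
    (hX : algClosureEmb ι X = ℘[L] z - (W.baseChange ℂ).b₂ / 12)
    (hY : algClosureEmb ι Y = (℘'[L] z - (W.baseChange ℂ).a₁ * (℘[L] z - (W.baseChange ℂ).b₂ / 12) - (W.baseChange ℂ).a₃) / 2) :
    algClosureEmb ι (g • X) = ℘[L] (ι (ψ 𝔟 : K) * z) - (W.baseChange ℂ).b₂ / 12 ∧
      algClosureEmb ι (g • Y) =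
        (℘'[L] (ι (ψ 𝔟 : K) * z) - (W.baseChange ℂ).a₁ * (℘[L] (ι (ψ 𝔟 : K) * z) - (W.baseChange ℂ).b₂ / 12) - (W.baseChange ℂ).a₃) / 2 := by
  have hb₂ : (W.baseChange ℂ).b₂ = (W.b₂ : ℂ) := by simp [WeierstrassCurve.baseChange, WeierstrassCurve.map_b₂]
  have ha₁ : (W.baseChange ℂ).a₁ = (W.a₁ : ℂ) := by simp [WeierstrassCurve.baseChange]
  have ha₃ : (W.baseChange ℂ).a₃ = (W.a₃ : ℂ) := by simp [WeierstrassCurve.baseChange]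
  -- the analytic coordinates `x = X + b₂/12`, `y = 2Y + a₁X + a₃` lie in `K(𝔣𝔠)` and read `℘ z`, `℘′ z`
  set F := rayClassField K (𝔣 * 𝔠)
  have hxm : X + (W.b₂ : AlgebraicClosure K) / 12 ∈ F := add_mem hXm (div_mem (intCast_mem F _) (ofNat_mem F 12))
  have hym : 2 * Y + (W.a₁ : AlgebraicClosure K) * X + (W.a₃ : AlgebraicClosure K) ∈ F :=
    add_mem (add_mem (mul_mem (ofNat_mem F 2) hYm) (mul_mem (intCast_mem F _) hXm)) (intCast_mem F _)
  have hx : algClosureEmb ι ((⟨_, hxm⟩ : F) : AlgebraicClosure K) = ℘[L] z := by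
    change algClosureEmb ι (X + (W.b₂ : AlgebraicClosure K) / 12) = _
    rw [map_add, map_div₀, map_intCast, map_ofNat, hX, hb₂]; ring
  have hy : algClosureEmb ι ((⟨_, hym⟩ : F) : AlgebraicClosure K) = ℘'[L] z := by
    change algClosureEmb ι (2 * Y + (W.a₁ : AlgebraicClosure K) * X + (W.a₃ : AlgebraicClosure K)) = _
    rw [map_add, map_add, map_mul, map_mul, map_ofNat, map_intCast, map_intCast, hX, hY, hb₂, ha₁, ha₃]; ring
  obtain ⟨h1, h2⟩ := algClosureEmb_smul_eq_of_absRestrictNormalHom_eq ι hvii𝔟 hg hz hz' hx hy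
  change algClosureEmb ι (g • (X + (W.b₂ : AlgebraicClosure K) / 12)) = _ at h1
  change algClosureEmb ι (g • (2 * Y + (W.a₁ : AlgebraicClosure K) * X + (W.a₃ : AlgebraicClosure K))) = _ at h2
  -- `g` acts by a `K`-algebra automorphism: it fixes the integer coefficients
  rw [absoluteGaloisGroup.smul_def] at h1 h2
  rw [absoluteGaloisGroup.smul_def, absoluteGaloisGroup.smul_def]
  simp only [map_add, map_mul, map_div₀, map_intCast, map_ofNat] at h1 h2
  rw [← hb₂] at h1
  rw [← ha₁, ← ha₃] at h2
  have e1 : algClosureEmb ι ((absoluteGaloisGroup.toAlgEquiv K g) X) = ℘[L] (ι (ψ 𝔟 : K) * z) - (W.baseChange ℂ).b₂ / 12 := by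
    linear_combination h1
  refine ⟨e1, ?_⟩
  rw [e1] at h2
  linear_combination h2 / 2

/-! ## §2 Label independence: equal model readings ⟹ arguments congruent modulo `Λ` ⟹ equal Eisenstein values -/

/-- ★ **Two arguments with the same MODEL readings are congruent modulo `Λ`**: if `z₁, z₂ ∉ Λ` and
`℘(z₁) − b = ℘(z₂) − b`, `(℘′(z₁) − a₁(℘(z₁) − b) − a₃)/2 = (℘′(z₂) − …)/2`, then `z₁ − z₂ ∈ Λ` (`℘, ℘′` separate the points of `ℂ/Λ ∖ 0`).
Used with `z_i = ι ψ(𝔟_i)·Ω` for two Artin representatives `𝔟₁, 𝔟₂` of the same `g`: the moved base point is label-free modulo `Λ`.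
[cite: SilvermanAEC2009, VI.3.6 (b)] [cite: deShalit1987, II §4.14 (38) (p. 71)] -/
theorem sub_mem_lattice_of_model_readings_eq {z₁ z₂ b a₁ a₃ : ℂ} (hz₁ : z₁ ∉ L.lattice) (hz₂ : z₂ ∉ L.lattice)
    (hX : ℘[L] z₁ - b = ℘[L] z₂ - b)
    (hY : (℘'[L] z₁ - a₁ * (℘[L] z₁ - b) - a₃) / 2 = (℘'[L] z₂ - a₁ * (℘[L] z₂ - b) - a₃) / 2) :
    z₁ - z₂ ∈ L.lattice := by
  have h1 : ℘[L] z₁ = ℘[L] z₂ := by linear_combination hX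
  have h2 : ℘'[L] z₁ = ℘'[L] z₂ := by rw [h1] at hY; linear_combination 2 * hY
  exact L.sub_mem_lattice_of_weierstrassP_eq hz₁ hz₂ h1 h2

/-- **Equal model readings ⟹ equal Eisenstein values** on every period pair `L′` whose lattice contains `Λ` (`E_k(·; Λ′)` is `Λ′`-periodic).
[cite: deShalit1987, II §3.1 (5) (p. 49), II §4.14 (38)] -/
theorem eisensteinE_eq_of_model_readings_eq {L' : PeriodPair} (hLL' : L.lattice ≤ L'.lattice) {z₁ z₂ b a₁ a₃ : ℂ}
    (hz₁ : z₁ ∉ L.lattice) (hz₂ : z₂ ∉ L.lattice) (hX : ℘[L] z₁ - b = ℘[L] z₂ - b)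
    (hY : (℘'[L] z₁ - a₁ * (℘[L] z₁ - b) - a₃) / 2 = (℘'[L] z₂ - a₁ * (℘[L] z₂ - b) - a₃) / 2) (k : ℕ) :
    L'.eisensteinE k z₁ = L'.eisensteinE k z₂ := by
  have h := hLL' (sub_mem_lattice_of_model_readings_eq hz₁ hz₂ hX hY)
  rw [show z₁ = z₂ + (z₁ - z₂) by ring, L'.eisensteinE_add_of_mem_lattice k h z₂]

/-! ## §3 The permutation of the division values induced by `g` -/

/-- ★ **The moved division values, re-indexed**: `Λ′ = 𝔞⁻¹Λ` with representatives `S`, both with `𝒪_K`-multiplication; `δ ∈ 𝒪_K` with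
`δ·ψ𝔟 ≡ 1` on `Λ′/Λ`; model `x`-readings `ι̂(X c) = ℘(c) − b₂/12` with `X c ∈ K(𝔣𝔠)` for `c ∈ S ∖ 0` (`S ∖ 0 ⊆ 𝔠⁻¹Λ ∖ Λ`); `g|_{K(𝔣𝔠)} = (𝔟, ·)`.
Then there is a bijection `e` of `S ∖ 0` (`e c ≡ δc`) with **`ι̂(g • X (e c)) = ℘(c) − b₂/12`** — so `X′ := X ∘ e` has the un-moved readings
through `ι̂ ∘ g` and presents the same product `∏_{c ∈ S∖0}`. [cite: deShalit1987, II §4.9 Proposition (ii) (proof, p. 63), II §2.3 (10)] -/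
theorem exists_perm_readings_of_absRestrictNormalHom_eq (W : WeierstrassCurve ℤ) {La : PeriodPair} {S : Finset ℂ}
    (hS : L.IsLatticeReps La S) (hΛ : IsCMLattice ι L.lattice) (hΛa : IsCMLattice ι La.lattice)
    (hLa𝔠 : La.lattice ≤ idealInvLattice ι 𝔠 L.lattice)
    (hvii𝔟 : ∀ z : ℂ, z ∈ idealInvLattice ι 𝔠 L.lattice → z ∉ L.lattice → ∀ x y : rayClassField K (𝔣 * 𝔠),
      algClosureEmb ι x = ℘[L] z → algClosureEmb ι y = ℘'[L] z →
        algClosureEmb ι (artinSymbol (galFrob K (rayClassField K (𝔣 * 𝔠))) 𝔟 x) = ℘[L] (ι (ψ 𝔟 : K) * z) ∧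
        algClosureEmb ι (artinSymbol (galFrob K (rayClassField K (𝔣 * 𝔠))) 𝔟 y) = ℘'[L] (ι (ψ 𝔟 : K) * z))
    {g : absoluteGaloisGroup K} (hg : absRestrictNormalHom (rayClassField K (𝔣 * 𝔠)) g = artinSymbol (galFrob K (rayClassField K (𝔣 * 𝔠))) 𝔟)
    {δ : 𝓞 K} (hδ : ∀ x ∈ La.lattice, ι ((δ * ψ 𝔟 : 𝓞 K) : K) * x - x ∈ L.lattice)
    (X Y : ℂ → AlgebraicClosure K) (hXm : ∀ c ∈ S.erase 0, X c ∈ rayClassField K (𝔣 * 𝔠)) (hYm : ∀ c ∈ S.erase 0, Y c ∈ rayClassField K (𝔣 * 𝔠))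
    (hX : ∀ c ∈ S.erase 0, algClosureEmb ι (X c) = ℘[L] c - (W.baseChange ℂ).b₂ / 12)
    (hY : ∀ c ∈ S.erase 0, algClosureEmb ι (Y c) =
      (℘'[L] c - (W.baseChange ℂ).a₁ * (℘[L] c - (W.baseChange ℂ).b₂ / 12) - (W.baseChange ℂ).a₃) / 2) :
    ∃ e : ℂ → ℂ, (∀ c ∈ S.erase 0, e c ∈ S.erase 0) ∧ (∀ c ∈ S.erase 0, ι (δ : K) * c - e c ∈ L.lattice) ∧
      Set.InjOn e (S.erase 0 : Finset ℂ) ∧ Set.SurjOn e (S.erase 0 : Finset ℂ) (S.erase 0 : Finset ℂ) ∧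
      ∀ c ∈ S.erase 0, algClosureEmb ι (g • X (e c)) = ℘[L] c - (W.baseChange ℂ).b₂ / 12 := by
  obtain ⟨e, heS, he, hinj, hsurj⟩ := exists_perm_of_mul_inv ι hS hΛ hΛa hδ
  refine ⟨e, heS, he, hinj, hsurj, fun c hc ↦ ?_⟩
  have hec := heS c hc
  obtain ⟨hec0, hecS⟩ := Finset.mem_erase.mp hec
  -- `e c ∈ Λ′ ∖ Λ ⊆ 𝔠⁻¹Λ ∖ Λ`
  have hecLa : e c ∈ La.lattice := rep_mem hS hecS
  have hecL : e c ∉ L.lattice := fun h ↦ hec0 (hS.distinct (e c) hecS 0 hS.zero_mem (by rwa [sub_zero]))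
  obtain ⟨h1, -⟩ := algClosureEmb_smul_model_eq_of_absRestrictNormalHom_eq ι W hvii𝔟 hg (hLa𝔠 hecLa) hecL (hXm _ hec) (hYm _ hec)
    (hX _ hec) (hY _ hec)
  rw [h1]
  -- `ψ𝔟 · e c ≡ ψ𝔟 δ c ≡ c (mod Λ)`
  have h2 : ι (ψ 𝔟 : K) * e c - c ∈ L.lattice := by
    have h3 : ι (ψ 𝔟 : K) * (ι (δ : K) * c - e c) ∈ L.lattice := hΛ (ψ 𝔟) _ (he c hc)
    have h4 := hδ c (rep_mem hS (Finset.mem_erase.mp hc).2)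
    have e1 : ι (ψ 𝔟 : K) * e c - c = (ι ((δ * ψ 𝔟 : 𝓞 K) : K) * c - c) - ι (ψ 𝔟 : K) * (ι (δ : K) * c - e c) := by
      push_cast; rw [map_mul]; ring
    rw [e1]
    exact L.lattice.sub_mem h4 h3
  rw [show ι (ψ 𝔟 : K) * e c = c + ((⟨ι (ψ 𝔟 : K) * e c - c, h2⟩ : L.lattice) : ℂ) by push_cast; ring, L.weierstrassP_add_coe]

end Literature.NumberTheory.ComplexMultiplication.EllipticUnits

end
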